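import Summits.BirchSwinnertonDyer.BirchSwinnertonDyer.Theorems.ManinLocalTwoThreeHeckeTransport
import Summits.BirchSwinnertonDyer.BirchSwinnertonDyer.Theorems.ManinLocalTwoThreeShiftRelationDepth
import HarnessLib

/-!
# `T_p` commutes with `Ad(W_t)` for an Atkin–Lehner element on `Hom(Γ₀(tL′), R)` (σ2 (a2) of MEMO-es §25.6)

Summit `BirchSwinnertonDyer`, route `ManinLocalTwoThree` (cell bsd-f2-manin), crux C2 `ManinOddAtFour` (stmt-BirchSwinnertonDyer-22967),
line `kato_shift_two` v6, stub 3 (`C₃`-image residual), vertex step **E-es-42 `AtkinLehnerStep`** (MEMO-es §25.3 (V-b); lead's file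
`Theorems/ManinLocalTwoThreeAtkinLehnerStep.lean` takes σ2 (a2) as its one input, cell INBOX 2026-08-28T04:27:26Z).  Setting: `t` prime,
`t ∤ L′`, `h ∈ Γ₀(L′)` with `t ∣ h₀₀`; then `W := diag(1,t)·h` is an Atkin–Lehner element of level `tL′` and `Ad(W)γ = A_t⁻¹ (hγh⁻¹) A_t`,
`A_t = diag(t,1)`, i.e. `hγh⁻¹` is the `t`-SHIFT of `Ad(W)γ` (es's `IsShiftConj t (hγh⁻¹) (Ad(W)γ)`, spelled out on entries).  In the
lead's currency — an arbitrary map `Φ : Γ₀(L′t) → Γ₀(L′t)` whose values satisfy that entry relation — we prove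
**`heckeU_zero_comp_atkinLehner`**: `(T_p (u ∘ Φ))(γ) = (T_p u)(Φ γ)` for every prime `p ≠ t`, every degree-`0` cocycle `u` and
every `γ`.  Ingredients: the conjugation formulas `sl_conj_eq` / `sl_inv_conj_eq`; `t ∣ (hMh⁻¹)₀₁` and `L′ ∣ (hMh⁻¹)₁₀` for
`M ∈ Δ₀^{L′t}`; the shifted-down matrix of `hMh⁻¹` lies in `Δ₀^{L′t}(n)` when `gcd(n,t) = 1` (`mem_delta0_of_shiftRelMat_conj`);
freeness of the transported representatives (`eq_of_shiftRelMat_conj_heckeRep`); and the abstract `heckeU_zero_comp_of_transport`.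
No new definitions; nothing about BSD or Manin's conjecture is proved here.

References: A. O. L. Atkin, J. Lehner, *Hecke operators on `Γ₀(m)`*, Math. Ann. 185 (1970) 134–160, Lemma 11; G. Shimura (1971)
§8.3 (8.3.2) [cite: Shimura1971, §8.3 (8.3.2)]; cell memo HOME/MEMO-es.md §25.3 (V-b), §25.6 σ2, §25.9.
-/

set_option autoImplicit false
set_option linter.dupNamespace false

open scoped MatrixGroups

open CongruenceSubgroup Matrix.SpecialLinearGroup Literature.NumberTheory.EllipticCurves.ModularForms
  Literature.NumberTheory.EllipticCurves.ModularForms.HidaCohomology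

namespace Summit.BirchSwinnertonDyer.BirchSwinnertonDyer.Theorems.ManinLocalTwoThree

/-! ### Conjugation formulas in `SL₂(ℤ)` -/

section ConjFormulas

/-- **`g M g⁻¹` on entries** for `g = (a b; c d) ∈ SL₂(ℤ)`, `g⁻¹ = (d, −b; −c, a)`. [folklore] -/
theorem sl_conj_eq (g : SL(2, ℤ)) (M : Matrix (Fin 2) (Fin 2) ℤ) :
    (g : Matrix (Fin 2) (Fin 2) ℤ) * M * ((g⁻¹ : SL(2, ℤ)) : Matrix (Fin 2) (Fin 2) ℤ) =
      !![(g 0 0 * M 0 0 + g 0 1 * M 1 0) * g 1 1 - (g 0 0 * M 0 1 + g 0 1 * M 1 1) * g 1 0,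
         -((g 0 0 * M 0 0 + g 0 1 * M 1 0) * g 0 1) + (g 0 0 * M 0 1 + g 0 1 * M 1 1) * g 0 0;
         (g 1 0 * M 0 0 + g 1 1 * M 1 0) * g 1 1 - (g 1 0 * M 0 1 + g 1 1 * M 1 1) * g 1 0,
         -((g 1 0 * M 0 0 + g 1 1 * M 1 0) * g 0 1) + (g 1 0 * M 0 1 + g 1 1 * M 1 1) * g 0 0] := by
  rw [Matrix.SpecialLinearGroup.coe_inv, Matrix.adjugate_fin_two]
  ext i j
  fin_cases i <;> fin_cases j <;> simp [Matrix.mul_apply, Fin.sum_univ_two] <;> ring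

/-- **`g⁻¹ M g` on entries** for `g = (a b; c d) ∈ SL₂(ℤ)`. [folklore] -/
theorem sl_inv_conj_eq (g : SL(2, ℤ)) (M : Matrix (Fin 2) (Fin 2) ℤ) :
    ((g⁻¹ : SL(2, ℤ)) : Matrix (Fin 2) (Fin 2) ℤ) * M * (g : Matrix (Fin 2) (Fin 2) ℤ) =
      !![(g 1 1 * M 0 0 - g 0 1 * M 1 0) * g 0 0 + (g 1 1 * M 0 1 - g 0 1 * M 1 1) * g 1 0,
         (g 1 1 * M 0 0 - g 0 1 * M 1 0) * g 0 1 + (g 1 1 * M 0 1 - g 0 1 * M 1 1) * g 1 1;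
         (-(g 1 0 * M 0 0) + g 0 0 * M 1 0) * g 0 0 + (-(g 1 0 * M 0 1) + g 0 0 * M 1 1) * g 1 0,
         (-(g 1 0 * M 0 0) + g 0 0 * M 1 0) * g 0 1 + (-(g 1 0 * M 0 1) + g 0 0 * M 1 1) * g 1 1] := by
  rw [Matrix.SpecialLinearGroup.coe_inv, Matrix.adjugate_fin_two]
  ext i j
  fin_cases i <;> fin_cases j <;> simp [Matrix.mul_apply, Fin.sum_univ_two, Matrix.vecMul, dotProduct] <;> ring

/-- `t ∣ (gMg⁻¹)₀₁` when `t ∣ g₀₀` and `t ∣ M₁₀`. [folklore] -/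
theorem dvd_sl_conj_apply_zero_one {t : ℤ} {g : SL(2, ℤ)} {M : Matrix (Fin 2) (Fin 2) ℤ} (hg : t ∣ g 0 0)
    (hM : t ∣ M 1 0) :
    t ∣ ((g : Matrix (Fin 2) (Fin 2) ℤ) * M * ((g⁻¹ : SL(2, ℤ)) : Matrix (Fin 2) (Fin 2) ℤ)) 0 1 := by
  obtain ⟨a₁, ha⟩ := hg
  obtain ⟨m₁, hm⟩ := hM
  rw [sl_conj_eq]
  simp only [Matrix.of_apply, Matrix.cons_val', Matrix.cons_val_zero, Matrix.cons_val_one, Matrix.empty_val',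
    Matrix.cons_val_fin_one]
  exact ⟨a₁ * (-(g 0 1 * M 0 0) + g 0 0 * M 0 1 + g 0 1 * M 1 1) - g 0 1 ^ 2 * m₁,
    by linear_combination (-(g 0 1 * M 0 0) + g 0 0 * M 0 1 + g 0 1 * M 1 1) * ha - g 0 1 ^ 2 * hm⟩

/-- `L ∣ (gMg⁻¹)₁₀` when `L ∣ g₁₀` and `L ∣ M₁₀`. [folklore] -/
theorem dvd_sl_conj_apply_one_zero {L : ℤ} {g : SL(2, ℤ)} {M : Matrix (Fin 2) (Fin 2) ℤ} (hg : L ∣ g 1 0)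
    (hM : L ∣ M 1 0) :
    L ∣ ((g : Matrix (Fin 2) (Fin 2) ℤ) * M * ((g⁻¹ : SL(2, ℤ)) : Matrix (Fin 2) (Fin 2) ℤ)) 1 0 := by
  obtain ⟨c₁, hc⟩ := hg
  obtain ⟨m₁, hm⟩ := hM
  rw [sl_conj_eq]
  simp only [Matrix.of_apply, Matrix.cons_val', Matrix.cons_val_zero, Matrix.cons_val_one, Matrix.empty_val',
    Matrix.cons_val_fin_one]
  exact ⟨c₁ * (M 0 0 * g 1 1 - M 0 1 * g 1 0 - g 1 1 * M 1 1) + g 1 1 ^ 2 * m₁,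
    by linear_combination (M 0 0 * g 1 1 - M 0 1 * g 1 0 - g 1 1 * M 1 1) * hc + g 1 1 ^ 2 * hm⟩

/-- `t ∣ (g⁻¹Mg)₁₀` when `t ∣ g₀₀` and `t ∣ M₀₁`. [folklore] -/
theorem dvd_sl_inv_conj_apply_one_zero {t : ℤ} {g : SL(2, ℤ)} {M : Matrix (Fin 2) (Fin 2) ℤ} (hg : t ∣ g 0 0)
    (hM : t ∣ M 0 1) :
    t ∣ (((g⁻¹ : SL(2, ℤ)) : Matrix (Fin 2) (Fin 2) ℤ) * M * (g : Matrix (Fin 2) (Fin 2) ℤ)) 1 0 := by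
  obtain ⟨a₁, ha⟩ := hg
  obtain ⟨m₁, hm⟩ := hM
  rw [sl_inv_conj_eq]
  simp only [Matrix.of_apply, Matrix.cons_val', Matrix.cons_val_zero, Matrix.cons_val_one, Matrix.empty_val',
    Matrix.cons_val_fin_one]
  exact ⟨a₁ * (-(g 1 0 * M 0 0) + g 0 0 * M 1 0 + g 1 0 * M 1 1) - g 1 0 ^ 2 * m₁,
    by linear_combination (-(g 1 0 * M 0 0) + g 0 0 * M 1 0 + g 1 0 * M 1 1) * ha - g 1 0 ^ 2 * hm⟩

end ConjFormulas

/-! ### The Atkin–Lehner transport `M ↦ A_t⁻¹ (h M h⁻¹) A_t` on `Δ₀^{L′t}` -/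

section AtkinLehner

variable {L' t : ℕ} (ht : t.Prime) (htL : ¬ t ∣ L') (h : Gamma0 L') (hht : (t : ℤ) ∣ (h : SL(2, ℤ)) 0 0)
include ht htL hht

omit ht htL hht in
/-- `L′ ∣ h₁₀` for `h ∈ Γ₀(L′)`. [folklore] -/
theorem natCast_dvd_gamma0_apply_one_zero {L : ℕ} (g : Gamma0 L) : (L : ℤ) ∣ (g : SL(2, ℤ)) 1 0 := by
  have hg := g.2
  rw [Gamma0_mem] at hg
  exact (ZMod.intCast_zmod_eq_zero_iff_dvd _ L).mp hg

omit ht htL in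
/-- **The shifted-down conjugate lies in `Δ₀^{L′t}(n)`**: if `M ∈ Δ₀^{L′t}(n)` with `gcd(n, t) = 1` and `Y` satisfies
`hMh⁻¹ = A_t Y A_t⁻¹` on entries, then `Y ∈ Δ₀^{L′t}(n)` — this is `W M W⁻¹ ∈ Δ₀^{L′t}(n)` for the Atkin–Lehner element
`W = diag(1,t)h`. [cite: Shimura1971, §8.3 (8.3.2)] -/
theorem mem_delta0_of_shiftRelMat_conj {n : ℤ} (hn : IsCoprime n t) {M Y : Matrix (Fin 2) (Fin 2) ℤ}
    (hM : M ∈ Delta0 (L' * t) n)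
    (hY : ((h : SL(2, ℤ)) * M * (((h : SL(2, ℤ))⁻¹ : SL(2, ℤ)) : Matrix (Fin 2) (Fin 2) ℤ)) 0 0 = Y 0 0 ∧
      ((h : SL(2, ℤ)) * M * (((h : SL(2, ℤ))⁻¹ : SL(2, ℤ)) : Matrix (Fin 2) (Fin 2) ℤ)) 0 1 = (t : ℤ) * Y 0 1 ∧
      (t : ℤ) * ((h : SL(2, ℤ)) * M * (((h : SL(2, ℤ))⁻¹ : SL(2, ℤ)) : Matrix (Fin 2) (Fin 2) ℤ)) 1 0 = Y 1 0 ∧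
      ((h : SL(2, ℤ)) * M * (((h : SL(2, ℤ))⁻¹ : SL(2, ℤ)) : Matrix (Fin 2) (Fin 2) ℤ)) 1 1 = Y 1 1) :
    Y ∈ Delta0 (L' * t) n := by
  obtain ⟨hdet, hM10, hcop⟩ := hM
  rw [Nat.cast_mul] at hM10 hcop
  have hdetg := det_entries (h : SL(2, ℤ))
  obtain ⟨h1, h2, h3, h4⟩ := hY
  refine ⟨?_, ?_, ?_⟩
  · -- determinant
    rw [← shiftRelMat_det (t : ℤ) ⟨h1, h2, h3, h4⟩, Matrix.det_mul, Matrix.det_mul, Matrix.SpecialLinearGroup.det_coe,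
      Matrix.SpecialLinearGroup.det_coe, one_mul, mul_one, hdet]
  · -- level: `Y₁₀ = t (hMh⁻¹)₁₀` and `L′ ∣ (hMh⁻¹)₁₀`
    rw [← h3, Nat.cast_mul, mul_comm (L' : ℤ)]
    exact mul_dvd_mul_left _ (dvd_sl_conj_apply_one_zero (natCast_dvd_gamma0_apply_one_zero h)
      ((dvd_mul_right _ _).trans hM10))
  · -- coprimality of `Y₀₀ = (hMh⁻¹)₀₀` with `L′ t`
    rw [← h1, Nat.cast_mul, sl_conj_eq]
    simp only [Matrix.of_apply, Matrix.cons_val', Matrix.cons_val_zero, Matrix.empty_val', Matrix.cons_val_fin_one]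
    obtain ⟨c₁, hc⟩ := natCast_dvd_gamma0_apply_one_zero h
    obtain ⟨m₁, hm⟩ := hM10
    obtain ⟨a₁, ha⟩ := hht
    refine IsCoprime.mul_right ?_ ?_
    · -- mod `L′`: `X₀₀ = M₀₀ + L′·k`
      have hcopL : IsCoprime (M 0 0) (L' : ℤ) := hcop.of_mul_right_left
      have key : ((h : SL(2, ℤ)) 0 0 * M 0 0 + (h : SL(2, ℤ)) 0 1 * M 1 0) * (h : SL(2, ℤ)) 1 1 -
          ((h : SL(2, ℤ)) 0 0 * M 0 1 + (h : SL(2, ℤ)) 0 1 * M 1 1) * (h : SL(2, ℤ)) 1 0 =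
          M 0 0 + ((h : SL(2, ℤ)) 0 1 * c₁ * (M 0 0 - M 1 1) + (h : SL(2, ℤ)) 0 1 * (h : SL(2, ℤ)) 1 1 * (t : ℤ) * m₁ -
            (h : SL(2, ℤ)) 0 0 * c₁ * M 0 1) * (L' : ℤ) := by
        linear_combination M 0 0 * hdetg + ((h : SL(2, ℤ)) 0 1 * (M 0 0 - M 1 1) - (h : SL(2, ℤ)) 0 0 * M 0 1) * hc +
          (h : SL(2, ℤ)) 0 1 * (h : SL(2, ℤ)) 1 1 * hm
      rw [key]
      exact hcopL.add_mul_right_left _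
    · -- mod `t`: `X₀₀ = M₁₁ + t·k'` and `M₀₀ M₁₁ ≡ n (mod t)`
      have hprod : IsCoprime (M 0 0 * M 1 1) (t : ℤ) := by
        have e : M 0 0 * M 1 1 = n + M 0 1 * (L' : ℤ) * m₁ * (t : ℤ) := by
          rw [Matrix.det_fin_two] at hdet
          linear_combination hdet + M 0 1 * hm
        rw [e]
        exact hn.add_mul_right_left _
      have hcopT : IsCoprime (M 1 1) (t : ℤ) := hprod.of_mul_left_right
      have key : ((h : SL(2, ℤ)) 0 0 * M 0 0 + (h : SL(2, ℤ)) 0 1 * M 1 0) * (h : SL(2, ℤ)) 1 1 -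
          ((h : SL(2, ℤ)) 0 0 * M 0 1 + (h : SL(2, ℤ)) 0 1 * M 1 1) * (h : SL(2, ℤ)) 1 0 =
          M 1 1 + (a₁ * ((h : SL(2, ℤ)) 1 1 * M 0 0 - (h : SL(2, ℤ)) 1 0 * M 0 1 - (h : SL(2, ℤ)) 1 1 * M 1 1) +
            (h : SL(2, ℤ)) 0 1 * (h : SL(2, ℤ)) 1 1 * (L' : ℤ) * m₁) * (t : ℤ) := by
        linear_combination M 1 1 * hdetg +
          ((h : SL(2, ℤ)) 1 1 * M 0 0 - (h : SL(2, ℤ)) 1 0 * M 0 1 - (h : SL(2, ℤ)) 1 1 * M 1 1) * ha +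
          (h : SL(2, ℤ)) 0 1 * (h : SL(2, ℤ)) 1 1 * hm
      rw [key]
      exact hcopT.add_mul_right_left _

/-- **Freeness of the transported representatives**: if `Y`, `Y′` are the shifted-down conjugates of the Hecke
representatives `βᵢ`, `βᵢ′` and `Y = ε Y′` with `ε ∈ Γ₀(L′t)`, then `i = i′` (pull `ε` back through `Ad(W)⁻¹`: the shift-up
`ε′` of `ε` has `h⁻¹ε′h ∈ Γ₀(L′t)` and `βᵢ = (h⁻¹ε′h) βᵢ′`). [cite: Shimura1971, §8.3 (8.3.2)] -/
theorem eq_of_shiftRelMat_conj_heckeRep {p : ℕ} (hp : p.Prime) (i i' : HeckeIdx (L' * t) p)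
    {Y Y' : Matrix (Fin 2) (Fin 2) ℤ}
    (hY : ((h : SL(2, ℤ)) * heckeRep p i.1 * (((h : SL(2, ℤ))⁻¹ : SL(2, ℤ)) : Matrix (Fin 2) (Fin 2) ℤ)) 0 0 = Y 0 0 ∧
      ((h : SL(2, ℤ)) * heckeRep p i.1 * (((h : SL(2, ℤ))⁻¹ : SL(2, ℤ)) : Matrix (Fin 2) (Fin 2) ℤ)) 0 1 = (t : ℤ) * Y 0 1 ∧
      (t : ℤ) * ((h : SL(2, ℤ)) * heckeRep p i.1 * (((h : SL(2, ℤ))⁻¹ : SL(2, ℤ)) : Matrix (Fin 2) (Fin 2) ℤ)) 1 0 = Y 1 0 ∧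
      ((h : SL(2, ℤ)) * heckeRep p i.1 * (((h : SL(2, ℤ))⁻¹ : SL(2, ℤ)) : Matrix (Fin 2) (Fin 2) ℤ)) 1 1 = Y 1 1)
    (hY' : ((h : SL(2, ℤ)) * heckeRep p i'.1 * (((h : SL(2, ℤ))⁻¹ : SL(2, ℤ)) : Matrix (Fin 2) (Fin 2) ℤ)) 0 0 = Y' 0 0 ∧
      ((h : SL(2, ℤ)) * heckeRep p i'.1 * (((h : SL(2, ℤ))⁻¹ : SL(2, ℤ)) : Matrix (Fin 2) (Fin 2) ℤ)) 0 1 = (t : ℤ) * Y' 0 1 ∧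
      (t : ℤ) * ((h : SL(2, ℤ)) * heckeRep p i'.1 * (((h : SL(2, ℤ))⁻¹ : SL(2, ℤ)) : Matrix (Fin 2) (Fin 2) ℤ)) 1 0 = Y' 1 0 ∧
      ((h : SL(2, ℤ)) * heckeRep p i'.1 * (((h : SL(2, ℤ))⁻¹ : SL(2, ℤ)) : Matrix (Fin 2) (Fin 2) ℤ)) 1 1 = Y' 1 1)
    (ε : Gamma0 (L' * t)) (hε : Y = gmat ε * Y') : i = i' := by
  have ht0 : (t : ℤ) ≠ 0 := by exact_mod_cast ht.ne_zero
  have hp1 : ¬ (p : ℤ) ∣ 1 := not_intCast_dvd_one hp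
  -- shift `ε` up: `ε′` with `ε′ = A_t ε A_t⁻¹`
  have hεt : (t : ℤ) ∣ (ε : SL(2, ℤ)) 1 0 :=
    (dvd_mul_left _ _).trans ((Nat.cast_mul L' t : ((L' * t : ℕ) : ℤ) = _) ▸ natCast_dvd_gamma0_apply_one_zero ε)
  obtain ⟨E, hE1, hE2, hE3, hE4⟩ := exists_shiftRel_up (ε : SL(2, ℤ)) hεt
  -- `h βᵢ h⁻¹ = ε′ (h βᵢ′ h⁻¹)`
  have hrel := shiftRelMat_mul (t : ℤ) (X := (E : Matrix (Fin 2) (Fin 2) ℤ)) (Y := gmat ε) ⟨hE1, hE2, hE3, hE4⟩ hY'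
  rw [← hε] at hrel
  have hX : ((h : SL(2, ℤ)) : Matrix (Fin 2) (Fin 2) ℤ) * heckeRep p i.1 * (((h : SL(2, ℤ))⁻¹ : SL(2, ℤ)) : Matrix (Fin 2) (Fin 2) ℤ) =
      (E : Matrix (Fin 2) (Fin 2) ℤ) *
        (((h : SL(2, ℤ)) : Matrix (Fin 2) (Fin 2) ℤ) * heckeRep p i'.1 * (((h : SL(2, ℤ))⁻¹ : SL(2, ℤ)) : Matrix (Fin 2) (Fin 2) ℤ)) :=
    shiftRelMat_left_unique (t : ℤ) ht0 hY hrel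
  -- `g := h⁻¹ ε′ h ∈ Γ₀(L′t)`
  let g : SL(2, ℤ) := (h : SL(2, ℤ))⁻¹ * E * (h : SL(2, ℤ))
  have hEL : E ∈ Gamma0 L' := by
    rw [Gamma0_mem, ZMod.intCast_zmod_eq_zero_iff_dvd]
    obtain ⟨e, he⟩ := natCast_dvd_gamma0_apply_one_zero ε
    refine ⟨e, mul_left_cancel₀ ht0 ?_⟩
    rw [hE3, he, Nat.cast_mul]; ring
  have hgL : g ∈ Gamma0 L' := Subgroup.mul_mem _ (Subgroup.mul_mem _ (Subgroup.inv_mem _ h.2) hEL) h.2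
  have hgt : (t : ℤ) ∣ g 1 0 := by
    show (t : ℤ) ∣ (((h : SL(2, ℤ))⁻¹ * E * (h : SL(2, ℤ)) : SL(2, ℤ)) : Matrix (Fin 2) (Fin 2) ℤ) 1 0
    rw [Matrix.SpecialLinearGroup.coe_mul, Matrix.SpecialLinearGroup.coe_mul]
    exact dvd_sl_inv_conj_apply_one_zero hht ⟨_, hE2⟩
  have hg : g ∈ Gamma0 (L' * t) := by
    rw [Gamma0_mem, ZMod.intCast_zmod_eq_zero_iff_dvd, Nat.cast_mul]
    have hcop : IsCoprime (L' : ℤ) (t : ℤ) :=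
      Nat.isCoprime_iff_coprime.mpr ((Nat.Prime.coprime_iff_not_dvd ht).mpr htL).symm
    exact hcop.mul_dvd (natCast_dvd_gamma0_apply_one_zero ⟨g, hgL⟩) hgt
  -- `βᵢ = g βᵢ′`
  have hβ : gmat ⟨g, hg⟩ * heckeRep p i'.1 = heckeRep p i.1 := by
    show ((((h : SL(2, ℤ))⁻¹ * E * (h : SL(2, ℤ)) : SL(2, ℤ)) : Matrix (Fin 2) (Fin 2) ℤ)) * heckeRep p i'.1 = heckeRep p i.1
    have e1 := congrArg (fun Z ↦ (((h : SL(2, ℤ))⁻¹ : SL(2, ℤ)) : Matrix (Fin 2) (Fin 2) ℤ) * Z * ((h : SL(2, ℤ)) : Matrix (Fin 2) (Fin 2) ℤ)) hX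
    simp only [Matrix.mul_assoc, coe_inv_mul_coe, Matrix.mul_one] at e1
    simp only [← Matrix.mul_assoc, coe_inv_mul_coe, Matrix.one_mul] at e1
    rw [Matrix.SpecialLinearGroup.coe_mul, Matrix.SpecialLinearGroup.coe_mul, e1]
  have hM : heckeRep p i.1 ∈ Delta0 (L' * t) (p * 1) := by simpa using heckeRep_mem_delta0 hp i
  have hu := existsUnique_mem_delta0_mul_heckeRep hp hp1 hM
  exact hu.unique ⟨1, one_mem_delta0_one, by rw [Matrix.one_mul]⟩ ⟨_, coe_mem_delta0_one ⟨g, hg⟩, hβ⟩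

/-- **σ2 (a2): `T_p` commutes with `Ad(W_t)`.**  Let `t` be prime, `t ∤ L′`, `h ∈ Γ₀(L′)` with `t ∣ h₀₀` (so
`W := diag(1,t)h` is an Atkin–Lehner element of level `tL′`), and let `Φ : Γ₀(L′t) → Γ₀(L′t)` be any map with
`hγh⁻¹ = A_t (Φγ) A_t⁻¹` on entries (es's `IsShiftConj t (hγh⁻¹) (Φ γ)`; i.e. `Φ = Ad(W)`).  Then for every prime `p ≠ t`,
every degree-`0` cocycle `u` on `Γ₀(L′t)` and every `γ`, `(T_p (u ∘ Φ))(γ) = (T_p u)(Φ γ)`.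
[cite: Shimura1971, §8.3 (8.3.2)] -/
theorem heckeU_zero_comp_atkinLehner {p : ℕ} [NeZero p] (hp : p.Prime) (hpt : p ≠ t) {R : Type*} [CommRing R]
    (Φ : Gamma0 (L' * t) → Gamma0 (L' * t))
    (hΦ : ∀ γ : Gamma0 (L' * t),
      ((h : SL(2, ℤ)) * (γ : SL(2, ℤ)) * (h : SL(2, ℤ))⁻¹) 0 0 = (Φ γ : SL(2, ℤ)) 0 0 ∧
      ((h : SL(2, ℤ)) * (γ : SL(2, ℤ)) * (h : SL(2, ℤ))⁻¹) 0 1 = (t : ℤ) * (Φ γ : SL(2, ℤ)) 0 1 ∧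
      (t : ℤ) * ((h : SL(2, ℤ)) * (γ : SL(2, ℤ)) * (h : SL(2, ℤ))⁻¹) 1 0 = (Φ γ : SL(2, ℤ)) 1 0 ∧
      ((h : SL(2, ℤ)) * (γ : SL(2, ℤ)) * (h : SL(2, ℤ))⁻¹) 1 1 = (Φ γ : SL(2, ℤ)) 1 1)
    {u : Gamma0 (L' * t) → Fin 1 → R} (hu : u ∈ cocycles 0 (L' * t) R) (γ : Gamma0 (L' * t)) :
    heckeU 0 (L' * t) R hp (u ∘ Φ) γ = heckeU 0 (L' * t) R hp u (Φ γ) := by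
  have ht0 : (t : ℤ) ≠ 0 := by exact_mod_cast ht.ne_zero
  -- matrix form of `hΦ`
  have hΦ' : ∀ δ : Gamma0 (L' * t),
      (((h : SL(2, ℤ)) : Matrix (Fin 2) (Fin 2) ℤ) * gmat δ * (((h : SL(2, ℤ))⁻¹ : SL(2, ℤ)) : Matrix (Fin 2) (Fin 2) ℤ)) 0 0 = gmat (Φ δ) 0 0 ∧
      (((h : SL(2, ℤ)) : Matrix (Fin 2) (Fin 2) ℤ) * gmat δ * (((h : SL(2, ℤ))⁻¹ : SL(2, ℤ)) : Matrix (Fin 2) (Fin 2) ℤ)) 0 1 =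
        (t : ℤ) * gmat (Φ δ) 0 1 ∧
      (t : ℤ) * (((h : SL(2, ℤ)) : Matrix (Fin 2) (Fin 2) ℤ) * gmat δ * (((h : SL(2, ℤ))⁻¹ : SL(2, ℤ)) : Matrix (Fin 2) (Fin 2) ℤ)) 1 0 =
        gmat (Φ δ) 1 0 ∧
      (((h : SL(2, ℤ)) : Matrix (Fin 2) (Fin 2) ℤ) * gmat δ * (((h : SL(2, ℤ))⁻¹ : SL(2, ℤ)) : Matrix (Fin 2) (Fin 2) ℤ)) 1 1 = gmat (Φ δ) 1 1 := by
    intro δ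
    have e : ((h : SL(2, ℤ)) : Matrix (Fin 2) (Fin 2) ℤ) * gmat δ * (((h : SL(2, ℤ))⁻¹ : SL(2, ℤ)) : Matrix (Fin 2) (Fin 2) ℤ) =
        (((h : SL(2, ℤ)) * (δ : SL(2, ℤ)) * (h : SL(2, ℤ))⁻¹ : SL(2, ℤ)) : Matrix (Fin 2) (Fin 2) ℤ) := by
      rw [Matrix.SpecialLinearGroup.coe_mul, Matrix.SpecialLinearGroup.coe_mul]
    rw [e]
    exact hΦ δ
  -- the transported representatives `ad i`: `h βᵢ h⁻¹ = A_t (ad i) A_t⁻¹`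
  have hex : ∀ i : HeckeIdx (L' * t) p, ∃ Y : Matrix (Fin 2) (Fin 2) ℤ,
      (((h : SL(2, ℤ)) : Matrix (Fin 2) (Fin 2) ℤ) * heckeRep p i.1 * (((h : SL(2, ℤ))⁻¹ : SL(2, ℤ)) : Matrix (Fin 2) (Fin 2) ℤ)) 0 0 = Y 0 0 ∧
      (((h : SL(2, ℤ)) : Matrix (Fin 2) (Fin 2) ℤ) * heckeRep p i.1 * (((h : SL(2, ℤ))⁻¹ : SL(2, ℤ)) : Matrix (Fin 2) (Fin 2) ℤ)) 0 1 = (t : ℤ) * Y 0 1 ∧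
      (t : ℤ) * (((h : SL(2, ℤ)) : Matrix (Fin 2) (Fin 2) ℤ) * heckeRep p i.1 * (((h : SL(2, ℤ))⁻¹ : SL(2, ℤ)) : Matrix (Fin 2) (Fin 2) ℤ)) 1 0 = Y 1 0 ∧
      (((h : SL(2, ℤ)) : Matrix (Fin 2) (Fin 2) ℤ) * heckeRep p i.1 * (((h : SL(2, ℤ))⁻¹ : SL(2, ℤ)) : Matrix (Fin 2) (Fin 2) ℤ)) 1 1 = Y 1 1 := by
    intro i
    refine exists_shiftRelMat_down (t : ℤ) (dvd_sl_conj_apply_zero_one hht ?_)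
    rcases i with ⟨_ | j, _⟩ <;> simp [heckeRep]
  choose ad had using hex
  have hcop : IsCoprime ((p : ℤ) * 1) (t : ℤ) := by
    rw [mul_one]
    exact Nat.isCoprime_iff_coprime.mpr ((Nat.coprime_primes hp ht).mpr hpt)
  refine heckeU_zero_comp_of_transport hp Φ ad (fun i ↦ ?_) (fun i i' ε hε ↦ ?_) hu γ (fun i ↦ ?_)
  · -- `ad i ∈ Δ₀^{L′t}(p)`
    have hM : heckeRep p i.1 ∈ Delta0 (L' * t) (p * 1) := by simpa using heckeRep_mem_delta0 hp i
    exact mem_delta0_of_shiftRelMat_conj h hht hcop hM (had i)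
  · -- freeness
    exact eq_of_shiftRelMat_conj_heckeRep ht htL h hht hp i i' (had i) (had i') ε hε
  · -- transport of the permutation data: both sides are the shift-down of `h βᵢ γ h⁻¹ = h γ′ᵢ β_{σ i} h⁻¹`
    have hL : ∀ X : Matrix (Fin 2) (Fin 2) ℤ,
        (((h : SL(2, ℤ))⁻¹ : SL(2, ℤ)) : Matrix (Fin 2) (Fin 2) ℤ) * (((h : SL(2, ℤ)) : Matrix (Fin 2) (Fin 2) ℤ) * X) = X :=
      fun X ↦ by rw [← Matrix.mul_assoc, coe_inv_mul_coe, Matrix.one_mul]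
    have r1 := shiftRelMat_mul (t : ℤ) (had i) (hΦ' γ)
    have r2 := shiftRelMat_mul (t : ℤ) (hΦ' (heckePermElt hp γ i)) (had (heckePerm hp γ i))
    have e : ((h : SL(2, ℤ)) : Matrix (Fin 2) (Fin 2) ℤ) * heckeRep p i.1 * (((h : SL(2, ℤ))⁻¹ : SL(2, ℤ)) : Matrix (Fin 2) (Fin 2) ℤ) *
        (((h : SL(2, ℤ)) : Matrix (Fin 2) (Fin 2) ℤ) * gmat γ * (((h : SL(2, ℤ))⁻¹ : SL(2, ℤ)) : Matrix (Fin 2) (Fin 2) ℤ)) =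
        ((h : SL(2, ℤ)) : Matrix (Fin 2) (Fin 2) ℤ) * gmat (heckePermElt hp γ i) * (((h : SL(2, ℤ))⁻¹ : SL(2, ℤ)) : Matrix (Fin 2) (Fin 2) ℤ) *
        (((h : SL(2, ℤ)) : Matrix (Fin 2) (Fin 2) ℤ) * heckeRep p (heckePerm hp γ i).1 * (((h : SL(2, ℤ))⁻¹ : SL(2, ℤ)) : Matrix (Fin 2) (Fin 2) ℤ)) := by
      simp only [Matrix.mul_assoc, hL]
      rw [← Matrix.mul_assoc (heckeRep p i.1), ← gmat_heckePermElt_mul hp γ i]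
      simp only [Matrix.mul_assoc]
    rw [e] at r1
    exact shiftRelMat_right_unique (t : ℤ) ht0 r1 r2

end AtkinLehner

end Summit.BirchSwinnertonDyer.BirchSwinnertonDyer.Theorems.ManinLocalTwoThree
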